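import Mathlib

/-!
# Principal ideals and Green's relations in `𝒫𝒯ₙ`

[Ganyushkin–Mazorchuk 2009, §4.2 (Theorems 4.2.1, 4.2.4, 4.2.8) and §4.5 (Theorem 4.5.1,
Corollary 4.5.2)], case `S = 𝒫𝒯ₙ`.  As in `PartialTransformations`, a partial transformation of
`X` is `α : X → Option X` (`none` = undefined), the product `(αβ)(x) = α(β(x))` is
`fun x => (β x).bind α`, `dom α = {x | (α x).isSome}`, `im α = {a | ∃ x, α x = some a}`,
`rank α = |im α|`, and the partition `π_α` of the book (`x π_α y` iff `α` is undefined at both or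
defined at both with the same value) is `α x = α y`.  The `𝒯ₙ` case is the file
`FullTransformationGreen`.

* Theorem 4.2.1: `β ∈ α S` iff `im β ⊆ im α` (`exists_eq_bind_iff_im_subset`);
* Theorem 4.2.4: `β ∈ S α` iff `dom β ⊆ dom α` and `π_α ⊆ π_β` (`exists_eq_bind_left_iff`);
* Theorem 4.2.8: `β ∈ S α S` iff `rank β ≤ rank α` (`exists_eq_bind_bind_iff_ncard_le`, `X` finite);
* Theorem 4.5.1: `α 𝓡 β` iff `im α = im β`; `α 𝓛 β` iff `dom α = dom β` and `π_α = π_β`;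
  `α 𝓗 β` iff both; `α 𝓓 β` iff `α 𝓙 β` iff `rank α = rank β` (`greenR_iff`, `greenL_iff`,
  `greenH_iff`, `greenD_iff`, `greenJ_iff`); Corollary 4.5.2: `𝓓 = 𝓙` (`greenD_iff_greenJ`).

## References
* [GanyushkinMazorchuk2009] O. Ganyushkin, V. Mazorchuk, *Classical Finite Transformation
  Semigroups. An Introduction*, Algebra and Applications 9, Springer, 2009, §4.2, §4.5.
-/

namespace Literature.Algebra.Semigroups.PartialTransformation

open Function Set

variable {X : Type*}

/-! ### §4.2: principal ideals -/

/-- Theorem 4.2.1 (`𝒫𝒯ₙ`): `β ∈ α𝒫𝒯(X)`, i.e. `β = αγ` for some `γ`, iff `im β ⊆ im α`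
(`γ` sends `x ∈ dom β` to a chosen preimage of `β(x)` under `α`).
[cite: GanyushkinMazorchuk2009, Theorem 4.2.1] -/
theorem exists_eq_bind_iff_im_subset (α β : X → Option X) :
    (∃ γ : X → Option X, ∀ x, β x = (γ x).bind α) ↔
      {b | ∃ x, β x = some b} ⊆ {a | ∃ x, α x = some a} := by
  classical
  constructor
  · rintro ⟨γ, hγ⟩ b ⟨x, hx⟩
    rw [hγ x] at hx
    obtain ⟨z, -, hz⟩ := Option.bind_eq_some_iff.1 hx
    exact ⟨z, hz⟩
  · intro h
    refine ⟨fun x => (β x).bind fun b =>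
      if hb : ∃ y, α y = some b then some (Classical.choose hb) else none, fun x => ?_⟩
    dsimp only
    rcases hx : β x with _ | b
    · rfl
    · have hb : ∃ y, α y = some b := h ⟨x, hx⟩
      simp only [Option.bind_some, hb, ↓reduceDIte]
      exact (Classical.choose_spec hb).symm

/-- Theorem 4.2.4 (`𝒫𝒯ₙ`): `β ∈ 𝒫𝒯(X)α`, i.e. `β = γα` for some `γ`, iff `dom β ⊆ dom α` and
`π_α ⊆ π_β` (`α(x) = α(y)` implies `β(x) = β(y)`).
[cite: GanyushkinMazorchuk2009, Theorem 4.2.4] -/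
theorem exists_eq_bind_left_iff (α β : X → Option X) :
    (∃ γ : X → Option X, ∀ x, β x = (α x).bind γ) ↔
      (∀ x, (β x).isSome → (α x).isSome) ∧ ∀ x y, α x = α y → β x = β y := by
  classical
  constructor
  · rintro ⟨γ, hγ⟩
    refine ⟨fun x hx => ?_, fun x y hxy => by rw [hγ x, hγ y, hxy]⟩
    rw [hγ x] at hx
    rcases hαx : α x with _ | a
    · simp [hαx] at hx
    · rfl
  · rintro ⟨hdom, hker⟩
    refine ⟨fun a => if ha : ∃ y, α y = some a then β (Classical.choose ha) else none,
      fun x => ?_⟩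
    rcases hx : α x with _ | a
    · rw [Option.bind_none]
      by_contra hβ
      have := hdom x (Option.isSome_iff_ne_none.2 hβ)
      simp [hx] at this
    · have ha : ∃ y, α y = some a := ⟨x, hx⟩
      simp only [Option.bind_some, ha, ↓reduceDIte]
      exact hker _ _ (hx.trans (Classical.choose_spec ha).symm)

/-- `im(αγ) ⊆ im(α)` and `|im(γα)| ≤ |im(α)|`: one-sided multiples do not increase the rank
(`X` finite). [folklore] -/
private theorem ncard_im_bind_le [Finite X] (α γ : X → Option X) :
    {b | ∃ x, (γ x).bind α = some b}.ncard ≤ {a | ∃ x, α x = some a}.ncard ∧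
      {b | ∃ x, (α x).bind γ = some b}.ncard ≤ {a | ∃ x, α x = some a}.ncard := by
  classical
  constructor
  · exact ncard_le_ncard ((exists_eq_bind_iff_im_subset α _).1 ⟨γ, fun _ => rfl⟩)
  · -- each `b ∈ im(γα)` is `γ(a)` for some `a ∈ im α`; choosing one gives an injection
    have hpre : ∀ b ∈ {b | ∃ x, (α x).bind γ = some b}, ∃ a, (∃ x, α x = some a) ∧ γ a = some b := by
      rintro b ⟨x, hx⟩
      obtain ⟨a, ha, hab⟩ := Option.bind_eq_some_iff.1 hx
      exact ⟨a, ⟨x, ha⟩, hab⟩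
    refine ncard_le_ncard_of_injOn (fun b => if hb : b ∈ {b | ∃ x, (α x).bind γ = some b} then
      Classical.choose (hpre b hb) else b) (fun b hb => ?_) (fun b₁ hb₁ b₂ hb₂ h => ?_)
      (toFinite _)
    · simp only [hb, ↓reduceDIte]
      exact (Classical.choose_spec (hpre b hb)).1
    · simp only [hb₁, hb₂, ↓reduceDIte] at h
      have h1 := (Classical.choose_spec (hpre b₁ hb₁)).2
      have h2 := (Classical.choose_spec (hpre b₂ hb₂)).2
      rw [h] at h1
      exact Option.some_inj.1 (h1.symm.trans h2)

/-- Theorem 4.2.8 (`𝒫𝒯ₙ`, `X` finite): `β ∈ 𝒫𝒯(X) α 𝒫𝒯(X)`, i.e. `β = γαδ`, iff `rank β ≤ rank α`.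
[cite: GanyushkinMazorchuk2009, Theorem 4.2.8] -/
theorem exists_eq_bind_bind_iff_ncard_le [Finite X] (α β : X → Option X) :
    (∃ γ δ : X → Option X, ∀ x, β x = ((δ x).bind α).bind γ) ↔
      {b | ∃ x, β x = some b}.ncard ≤ {a | ∃ x, α x = some a}.ncard := by
  classical
  constructor
  · rintro ⟨γ, δ, h⟩
    have h1 := (ncard_im_bind_le (fun x => (δ x).bind α) γ).2
    have h2 := (ncard_im_bind_le α δ).1
    have hβ : {b | ∃ x, β x = some b} = {b | ∃ x, ((δ x).bind α).bind γ = some b} := by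
      ext b; simp only [mem_setOf_eq, h]
    rw [hβ]
    exact h1.trans h2
  · intro h
    haveI := Fintype.ofFinite {b | ∃ x, β x = some b}
    haveI := Fintype.ofFinite {a | ∃ x, α x = some a}
    have hcard : Fintype.card {b | ∃ x, β x = some b} ≤ Fintype.card {a | ∃ x, α x = some a} := by
      rwa [← Nat.card_eq_fintype_card, ← Nat.card_eq_fintype_card, Nat.card_coe_set_eq,
        Nat.card_coe_set_eq]
    obtain ⟨ι⟩ := Function.Embedding.nonempty_of_card_le hcard
    -- `δ` : `x ∈ dom β ↦` a preimage under `α` of `ι(β x)`; `γ` : `ι(b) ↦ b`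
    have hpre : ∀ b : {b | ∃ x, β x = some b}, ∃ c, α c = some (ι b : X) := fun b => (ι b).2
    choose pre hpre using hpre
    refine ⟨fun c => if hc : ∃ b : {b | ∃ x, β x = some b}, (ι b : X) = c
        then some (Classical.choose hc).1 else none,
      fun x => (β x).bind fun b => if hb : b ∈ {b | ∃ x, β x = some b} then some (pre ⟨b, hb⟩)
        else none, fun x => ?_⟩
    dsimp only
    rcases hx : β x with _ | b
    · rfl
    · have hb : b ∈ {b | ∃ x, β x = some b} := ⟨x, hx⟩
      rw [Option.bind_some, dif_pos hb, Option.bind_some, hpre, Option.bind_some]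
      have hc : ∃ b' : {b | ∃ x, β x = some b}, (ι b' : X) = ι ⟨b, hb⟩ := ⟨⟨b, hb⟩, rfl⟩
      rw [dif_pos hc]
      have := ι.injective (Subtype.val_injective (Classical.choose_spec hc))
      rw [this]

/-! ### §4.5: Green's relations on `𝒫𝒯(X)` -/

/-- Theorem 4.5.1 (i) (`𝒫𝒯ₙ`): `α 𝓡 β` (`α ∈ βS`, `β ∈ αS`) iff `im α = im β`.
[cite: GanyushkinMazorchuk2009, Theorem 4.5.1 (i)] -/
theorem greenR_iff (α β : X → Option X) :
    ((∃ γ : X → Option X, ∀ x, α x = (γ x).bind β) ∧ ∃ δ : X → Option X, ∀ x, β x = (δ x).bind α) ↔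
      {a | ∃ x, α x = some a} = {b | ∃ x, β x = some b} := by
  rw [exists_eq_bind_iff_im_subset, exists_eq_bind_iff_im_subset]
  exact ⟨fun h => Subset.antisymm h.1 h.2, fun h => ⟨h.le, h.ge⟩⟩

/-- Theorem 4.5.1 (ii) (`𝒫𝒯ₙ`): `α 𝓛 β` (`α ∈ Sβ`, `β ∈ Sα`) iff `dom α = dom β` and `π_α = π_β`.
[cite: GanyushkinMazorchuk2009, Theorem 4.5.1 (ii)] -/
theorem greenL_iff (α β : X → Option X) :
    ((∃ γ : X → Option X, ∀ x, α x = (β x).bind γ) ∧ ∃ δ : X → Option X, ∀ x, β x = (α x).bind δ) ↔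
      (∀ x, (α x).isSome ↔ (β x).isSome) ∧ ∀ x y, α x = α y ↔ β x = β y := by
  rw [exists_eq_bind_left_iff, exists_eq_bind_left_iff]
  constructor
  · rintro ⟨⟨h1, h2⟩, h3, h4⟩
    exact ⟨fun x => ⟨h1 x, h3 x⟩, fun x y => ⟨h4 x y, h2 x y⟩⟩
  · rintro ⟨h1, h2⟩
    exact ⟨⟨fun x => (h1 x).1, fun x y => (h2 x y).2⟩, fun x => (h1 x).2, fun x y => (h2 x y).1⟩

/-- Theorem 4.5.1 (iii) (`𝒫𝒯ₙ`): `α 𝓗 β` iff `im α = im β`, `dom α = dom β` and `π_α = π_β`.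
[cite: GanyushkinMazorchuk2009, Theorem 4.5.1 (iii)] -/
theorem greenH_iff (α β : X → Option X) :
    (((∃ γ : X → Option X, ∀ x, α x = (γ x).bind β) ∧ ∃ δ : X → Option X, ∀ x, β x = (δ x).bind α) ∧
      ((∃ γ : X → Option X, ∀ x, α x = (β x).bind γ) ∧ ∃ δ : X → Option X, ∀ x, β x = (α x).bind δ)) ↔
      {a | ∃ x, α x = some a} = {b | ∃ x, β x = some b} ∧
        ((∀ x, (α x).isSome ↔ (β x).isSome) ∧ ∀ x y, α x = α y ↔ β x = β y) := by
  rw [greenR_iff, greenL_iff]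

/-- Theorem 4.5.1 (v) (`𝒫𝒯ₙ`, `X` finite): `α 𝓙 β` iff `rank α = rank β`.
[cite: GanyushkinMazorchuk2009, Theorem 4.5.1 (v)] -/
theorem greenJ_iff [Finite X] (α β : X → Option X) :
    ((∃ γ δ : X → Option X, ∀ x, α x = ((δ x).bind β).bind γ) ∧
        ∃ γ δ : X → Option X, ∀ x, β x = ((δ x).bind α).bind γ) ↔
      {a | ∃ x, α x = some a}.ncard = {b | ∃ x, β x = some b}.ncard := by
  rw [exists_eq_bind_bind_iff_ncard_le, exists_eq_bind_bind_iff_ncard_le]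
  exact ⟨fun h => le_antisymm h.1 h.2, fun h => ⟨h.le, h.ge⟩⟩

/-- Theorem 4.5.1 (iv) (`𝒫𝒯ₙ`, `X` finite): `α 𝓓 β` (i.e. `α 𝓛 γ 𝓡 β` for some `γ`) iff
`rank α = rank β`: given equal ranks, `γ = σα` for a bijection `σ : im α → im β`.
[cite: GanyushkinMazorchuk2009, Theorem 4.5.1 (iv)] -/
theorem greenD_iff [Finite X] (α β : X → Option X) :
    (∃ γ : X → Option X,
        ((∃ μ : X → Option X, ∀ x, α x = (γ x).bind μ) ∧ ∃ ν : X → Option X, ∀ x, γ x = (α x).bind ν) ∧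
        ((∃ μ : X → Option X, ∀ x, γ x = (μ x).bind β) ∧ ∃ ν : X → Option X, ∀ x, β x = (ν x).bind γ)) ↔
      {a | ∃ x, α x = some a}.ncard = {b | ∃ x, β x = some b}.ncard := by
  classical
  constructor
  · rintro ⟨γ, ⟨⟨μ, hμ⟩, ⟨ν, hν⟩⟩, hR⟩
    -- `𝓛`-related elements have the same rank, `𝓡`-related elements the same image
    have h1 := (ncard_im_bind_le γ μ).2
    have h2 := (ncard_im_bind_le α ν).2
    have hα : {a | ∃ x, α x = some a} = {b | ∃ x, (γ x).bind μ = some b} := by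
      ext b; simp only [mem_setOf_eq, hμ]
    have hγ : {a | ∃ x, γ x = some a} = {b | ∃ x, (α x).bind ν = some b} := by
      ext b; simp only [mem_setOf_eq, hν]
    rw [← hα] at h1
    rw [← hγ] at h2
    rw [← (greenR_iff γ β).1 hR]
    exact le_antisymm h1 h2
  · intro h
    have hcard : Nat.card {a | ∃ x, α x = some a} = Nat.card {b | ∃ x, β x = some b} := by
      rwa [Nat.card_coe_set_eq, Nat.card_coe_set_eq]
    obtain ⟨e⟩ := Finite.card_eq.1 hcard
    -- `σ` = `e` on `im α`; `γ = σα`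
    let σ : X → X := fun a => if ha : ∃ x, α x = some a then (e ⟨a, ha⟩ : X) else a
    have hσ : ∀ a (ha : ∃ x, α x = some a), σ a = (e ⟨a, ha⟩ : X) := fun a ha => dif_pos ha
    have hσinj : ∀ a a', (∃ x, α x = some a) → (∃ x, α x = some a') → σ a = σ a' → a = a' := by
      intro a a' ha ha' hh
      rw [hσ a ha, hσ a' ha'] at hh
      exact congrArg Subtype.val (e.injective (Subtype.val_injective hh))
    refine ⟨fun x => (α x).map σ, ?_, ?_⟩
    · rw [greenL_iff]
      refine ⟨fun x => by simp, fun x y => ⟨fun hxy => by rw [hxy], fun hxy => ?_⟩⟩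
      rcases hx : α x with _ | a <;> rcases hy : α y with _ | a'
      · rfl
      · simp [hx, hy] at hxy
      · simp [hx, hy] at hxy
      · simp only [hx, hy, Option.map_some, Option.some.injEq] at hxy
        rw [hσinj a a' ⟨x, hx⟩ ⟨y, hy⟩ hxy]
    · rw [greenR_iff]
      ext c
      simp only [mem_setOf_eq, Option.map_eq_some_iff]
      constructor
      · rintro ⟨x, a, hxa, rfl⟩
        rw [hσ a ⟨x, hxa⟩]
        exact (e ⟨a, x, hxa⟩).2
      · rintro hc
        obtain ⟨x, hx⟩ := (e.symm ⟨c, hc⟩).2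
        refine ⟨x, _, hx, ?_⟩
        rw [hσ _ ⟨x, hx⟩]
        have : (⟨(e.symm ⟨c, hc⟩ : X), (e.symm ⟨c, hc⟩).2⟩ : {a | ∃ x, α x = some a}) =
            e.symm ⟨c, hc⟩ := rfl
        rw [this, Equiv.apply_symm_apply]

/-- Corollary 4.5.2 (`𝒫𝒯ₙ`, `X` finite): `𝓓 = 𝓙`. [cite: GanyushkinMazorchuk2009, Corollary 4.5.2] -/
theorem greenD_iff_greenJ [Finite X] (α β : X → Option X) :
    (∃ γ : X → Option X,
        ((∃ μ : X → Option X, ∀ x, α x = (γ x).bind μ) ∧ ∃ ν : X → Option X, ∀ x, γ x = (α x).bind ν) ∧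
        ((∃ μ : X → Option X, ∀ x, γ x = (μ x).bind β) ∧ ∃ ν : X → Option X, ∀ x, β x = (ν x).bind γ)) ↔
      ((∃ γ δ : X → Option X, ∀ x, α x = ((δ x).bind β).bind γ) ∧
        ∃ γ δ : X → Option X, ∀ x, β x = ((δ x).bind α).bind γ) := by
  rw [greenD_iff, greenJ_iff]

end Literature.Algebra.Semigroups.PartialTransformation
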